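import Summits.CriticalPhenomena.CardyFormulaZ2.Theorems.CardyComplexConeParafermionToSLESixFamiliesCondObsBound
import Literature.Probability.Percolation.InterfaceTraversalBound
import HarnessLib

/-!
# The phase-free power bound for the conditional parafermionic amplitude
(glue `condObs_powerBound` for line `caratheodory-net-slit-uniformity`)

Crux `ParafermionToSLESixFamilies` (stmt-CriticalPhenomena-11389), stub slot
`stub_koebeShadowSquares` (K1) of the checked skeleton
`Cruxes/ParafermionToSLESixFamilies/Lines/caratheodory_net_slit_uniformity.lean`.

K1 (`KoebeShadowSquares`) asks for `‖condObs E (Q(a,n)) ξ z‖ ≤ C·n^{-1/3}` uniformly in the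
admissible datum `E`, the outer configuration `ξ` and the lattice edge `z ∋ a` at the centre of
the square `Q(a, n)` below an interior `3nδ`-ball: the conjectured `(δ/depth)^{1/3}` envelope
(Duminil-Copin–Smirnov 2012, Conj. 8.7 + Koebe) = mixed two-arm decay `n^{-1/4}` times a UNIFORM
winding-phase cancellation `n^{-1/12}` (`κσ²/8` at `κ = 6`, `σ = 1/3`); no technique in the tree
(RSW, BK, annulus bounds — all blind to the phase `exp(-iW/3)`) reaches the exponent `1/3`.

This file proves the honest, phase-free part with the SAME quantifier structure
(`condObs_powerBound`): absolute `C`, `α > 0` with `‖condObs E (Q(a,n)) ξ z‖ ≤ C·n^{-α}`.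
Argument (positive-quantity only): along the cut orbit of the turning rule the left vertex is
joined to the vertex `v_A ∈ ∂Ω_δ` of the start corner by edges open in the completed configuration
(§1); a discrete boundary site is within sup-distance `δ` of a point off `Ω`, so under the ball
hypothesis the square contains no site of `∂Ω_δ` — the outer configuration `ξ` cannot plant wired
sites or `e_a` inside the square (§2–§3); inside the square the completed spliced configuration
reads the FRESH `ω` (§4); stopping the open path from the left vertex of the passage (an endpoint
of `z`) to `v_A` at its first exit gives an `ω`-open crossing of the annulus `A(a; r, n)` at mesh
`1` (§5–§6); the RSW annulus bound `annulusOpenCrossing_half_le_holds` and the pathwise envelope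
`‖passageSum‖ ≤ 2` (`norm_passageSum_medialExploration_le_two`) give `2 (r/n)^α`, and
`C = 2 (2r)^α` also covers `n < 2r` (§7).

Sources: Smirnov, C. R. Acad. Sci. 333 (2001), §2; Grimmett, *Percolation* (1999), §11.7–11.8
(RSW annulus decay); Duminil-Copin–Smirnov, arXiv:1109.1549, Conj. 8.7 (the exponent NOT reached).
-/

noncomputable section

open scoped Topology NNReal ENNReal Pointwise
open Filter Set MeasureTheory
open Literature.Probability Literature.Probability.LatticeModels Literature.Probability.Percolation

namespace Summit.CriticalPhenomena.CardyFormulaZ2.Cruxes.ParafermionToSLESixFamilies.CaratheodoryNetSlitUniformity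

/-! ### §1 Left vertices of the exploration are joined to the start vertex by open edges -/

/-- Along the orbit of the successor map the left vertex stays in the open cluster, for the
completed configuration `β`, of the vertex of the initial corner: following an open edge moves
the left vertex across that edge, crossing a closed edge keeps it. -/
theorem reachable_cornerOrbit (β : BondConfig (Site 2)) (c₀ : Site 2 × Fin 4) :
    ∀ n : ℕ, (openGraph β).Reachable c₀.1 (cornerOrbit β c₀ n).1
  | 0 => SimpleGraph.Reachable.refl _
  | n + 1 => by
    have ih := reachable_cornerOrbit β c₀ n
    show (openGraph β).Reachable c₀.1 (nextCorner β (cornerOrbit β c₀ n)).1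
    by_cases h : cTgt (cornerOrbit β c₀ n) ∈ β
    · rw [nextCorner_of_mem h]
      refine ih.trans (SimpleGraph.Adj.reachable ?_)
      rw [openGraph_adj]
      refine ⟨h, fun heq => cornerUnit_ne_zero (((cornerOrbit β c₀ n)).2 + 1) ?_⟩
      simpa using heq.symm
    · rw [nextCorner_of_not_mem h]
      exact ih

/-! ### §2 Discrete boundary sites sit next to points off the domain -/

/-- Lattice neighbours have coordinates differing by at most one (real form). -/
theorem abs_cast_sub_le_one_of_adj {x y : Site 2} (h : (zdGraph 2).Adj x y) (k : Fin 2) :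
    |((y k : ℤ) : ℝ) - x k| ≤ 1 := by
  have hz : |y k - x k| ≤ (1 : ℤ) := by
    rw [abs_le]
    rcases (Percolation.zdGraph_two_adj_iff x y).1 h with ⟨h0, h1⟩ | ⟨h0, h1⟩ | ⟨h1, h0⟩ | ⟨h1, h0⟩ <;>
      fin_cases k <;> simp <;> omega
  have : (((|y k - x k| : ℤ)) : ℝ) ≤ 1 := by exact_mod_cast hz
  simpa [Int.cast_abs, Int.cast_sub] using this

/-- **A discrete boundary site is within sup-distance `δ` of a point off `Ω`.** A site of
`meshBoundary` has a lattice edge that is not an edge of `Ω_δ` (it leaves `Ω̄`, or it ends at a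
mesh point off `Ω` — a mesh vertex joined to `Ω_δ` in the mesh graph would lie in `Ω_δ`); a corner
of a non-inner face has a point of that closed face off `Ω` (otherwise all four corners are mesh
vertices of the component of `u` and all four sides are mesh edges, so the face is inner). -/
theorem exists_not_mem_of_mem_zdBoundary {E : DiscreteDobrushin} (hδ : 0 < E.δ) {u : Site 2}
    (hu : u ∈ E.zdBoundary) :
    ∃ q : ℂ, q ∉ E.Ω ∧ |q.re - (meshPoint E.δ u).re| ≤ E.δ ∧ |q.im - (meshPoint E.δ u).im| ≤ E.δ := by
  rcases E.mem_zdBoundary_iff.1 hu with hu' | ⟨y, hadj, -, g, hg, hug, -⟩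
  · -- `u ∈ meshBoundary`: a lattice neighbour `y` not `Ω_δ`-adjacent
    obtain ⟨huD, y, hzd, hnadj⟩ := mem_meshBoundary_iff.1 hu'
    have hy0 := abs_cast_sub_le_one_of_adj hzd 0
    have hy1 := abs_cast_sub_le_one_of_adj hzd 1
    by_cases hseg : segment ℝ (meshPoint E.δ u) (meshPoint E.δ y) ⊆ closure E.Ω
    · -- then `δy ∉ Ω` (else `y ∈ Ω_δ` and the edge would be an edge of `Ω_δ`)
      have hyΩ : meshPoint E.δ y ∉ E.Ω := by
        intro hyΩ
        apply hnadj
        rw [discreteDomainGraph_adj_iff]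
        have hmesh : (meshGraph E.Ω E.δ).Adj u y := meshGraph_adj_iff.2 ⟨hzd, hseg⟩
        exact ⟨hmesh, huD, mem_meshDomain_of_meshGraph_adj huD hyΩ hmesh⟩
      refine ⟨meshPoint E.δ y, hyΩ, ?_, ?_⟩
      · rw [meshPoint_re, meshPoint_re, ← mul_sub, abs_mul, abs_of_pos hδ]
        exact mul_le_of_le_one_right hδ.le hy0
      · rw [meshPoint_im, meshPoint_im, ← mul_sub, abs_mul, abs_of_pos hδ]
        exact mul_le_of_le_one_right hδ.le hy1
    · -- the edge leaves `Ω̄` at some point `q`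
      obtain ⟨q, hq, hqΩ⟩ := Set.not_subset.1 hseg
      refine ⟨q, fun h => hqΩ (subset_closure h), ?_⟩
      rw [segment_eq_image'] at hq
      obtain ⟨t, ⟨ht0, ht1⟩, rfl⟩ := hq
      have ht : |t| ≤ 1 := abs_le.2 ⟨by linarith, ht1⟩
      constructor
      · have : (meshPoint E.δ u + t • (meshPoint E.δ y - meshPoint E.δ u)).re - (meshPoint E.δ u).re =
            t * (E.δ * (((y 0 : ℤ) : ℝ) - u 0)) := by
          simp only [Complex.add_re, Complex.real_smul, Complex.mul_re, Complex.ofReal_re,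
            Complex.ofReal_im, Complex.sub_re, meshPoint_re]
          ring
        rw [this, abs_mul, abs_mul, abs_of_pos hδ]
        nlinarith [mul_le_mul ht hy0 (abs_nonneg _) zero_le_one, abs_nonneg t]
      · have : (meshPoint E.δ u + t • (meshPoint E.δ y - meshPoint E.δ u)).im - (meshPoint E.δ u).im =
            t * (E.δ * (((y 1 : ℤ) : ℝ) - u 1)) := by
          simp only [Complex.add_im, Complex.real_smul, Complex.mul_im, Complex.ofReal_re,
            Complex.ofReal_im, Complex.sub_im, meshPoint_im]
          ring
        rw [this, abs_mul, abs_mul, abs_of_pos hδ]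
        nlinarith [mul_le_mul ht hy1 (abs_nonneg _) zero_le_one, abs_nonneg t]
  · -- `u` is a corner of a non-inner face `g`: some point of the closed face `δ • g` is off `Ω`
    have huD : u ∈ meshDomain E.Ω E.δ := (discreteDomainGraph_adj_iff.1 hadj).2.1
    have hsq : ∃ q ∈ E.δ • closedSq g, q ∉ E.Ω := by
      by_contra hall
      push Not at hall
      apply hg
      -- all corners are mesh vertices, all sides are mesh edges: `g` is inner
      have hvert : ∀ v, IsCorner v g → meshPoint E.δ v ∈ E.Ω := fun v hv =>
        hall _ (by rw [meshPoint_eq_smul]; exact Set.smul_mem_smul_set (toComplex_mem_closedSq hv))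
      have hmesh : ∀ v w, IsCorner v g → IsCorner w g → (zdGraph 2).Adj v w →
          (meshGraph E.Ω E.δ).Adj v w := by
        intro v w hv hw hvw
        refine meshGraph_adj_iff.2 ⟨hvw, fun p hp => subset_closure (hall p ?_)⟩
        rw [meshPoint_eq_smul, meshPoint_eq_smul, ← smul_segment_eq] at hp
        obtain ⟨p', hp', rfl⟩ := hp
        exact Set.smul_mem_smul_set ((convex_closedSq g).segment_subset (toComplex_mem_closedSq hv)
          (toComplex_mem_closedSq hw) hp')
      have hdom : ∀ v, IsCorner v g → v ∈ meshDomain E.Ω E.δ := by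
        intro v hv
        rcases IsCorner.exists_adj_chain hug hv with rfl | h | ⟨c, hc, h1, h2⟩
        · exact huD
        · exact mem_meshDomain_of_meshGraph_adj huD (hvert v hv) (hmesh _ _ hug hv h)
        · exact mem_meshDomain_of_meshGraph_adj
            (mem_meshDomain_of_meshGraph_adj huD (hvert c hc) (hmesh _ _ hug hc h1))
            (hvert v hv) (hmesh _ _ hc hv h2)
      intro v w hv hw hvw
      exact discreteDomainGraph_adj_iff.2 ⟨hmesh v w hv hw hvw, hdom v hv, hdom w hw⟩
    obtain ⟨q, hq, hqΩ⟩ := hsq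
    obtain ⟨p, hp, rfl⟩ := Set.mem_smul_set.1 hq
    refine ⟨E.δ • p, hqΩ, ?_⟩
    have key : ∀ k, |E.δ * coordVec p k - E.δ * (u k : ℝ)| ≤ E.δ := by
      intro k
      rw [← mul_sub, abs_mul, abs_of_pos hδ]
      refine mul_le_of_le_one_right hδ.le (abs_le.2 ?_)
      obtain ⟨h1, h2⟩ := hp k
      rcases hug.coord_cases k with ⟨-, h⟩ | ⟨-, h⟩ <;> rw [h] <;> constructor <;> linarith
    constructor
    · simpa [coordVec] using key 0
    · simpa [coordVec] using key 1

/-! ### §3 The lattice square below an interior ball carries no boundary site -/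

/-- With the closed `3nδ`-ball about `δa` inside the domain (`n ≥ 1`), no site of the lattice
square `Q(a, n)` is a discrete boundary site: a point within sup-distance `δ` of such a site is
within Euclidean distance `√2 (n + 1) δ ≤ 3nδ` of `δa`, hence in `Ω`. -/
theorem not_mem_zdBoundary_of_mem_latticeBox {E : DiscreteDobrushin} (hδ : 0 < E.δ) {a : Site 2}
    {n : ℕ} (hn : 1 ≤ n) (hball : Metric.closedBall (meshPoint E.δ a) (3 * n * E.δ) ⊆ E.Ω)
    {u : Site 2} (hu : u ∈ latticeBox a n) : u ∉ E.zdBoundary := by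
  intro huB
  obtain ⟨q, hqΩ, hre, him⟩ := exists_not_mem_of_mem_zdBoundary hδ huB
  apply hqΩ
  apply hball
  rw [Metric.mem_closedBall, Complex.dist_eq]
  have hn' : (1 : ℝ) ≤ n := by exact_mod_cast hn
  have hui : ∀ i, |((u i : ℤ) : ℝ) - a i| ≤ n := fun i => by
    have h' : ((|u i - a i| : ℤ) : ℝ) ≤ (n : ℤ) := by exact_mod_cast hu i
    simpa [Int.cast_abs, Int.cast_sub] using h'
  -- triangle inequality per coordinate: `|q_i - δa_i| ≤ |q_i - δu_i| + δ|u_i - a_i| ≤ (n+1)δ`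
  have tri : ∀ (qc : ℝ) (i : Fin 2), |qc - E.δ * u i| ≤ E.δ → |qc - E.δ * a i| ≤ (n + 1) * E.δ := by
    intro qc i hq
    have h2 : |E.δ * u i - E.δ * a i| ≤ n * E.δ := by
      rw [← mul_sub, abs_mul, abs_of_pos hδ, mul_comm]
      exact mul_le_mul_of_nonneg_right (hui i) hδ.le
    linarith [abs_sub_le qc (E.δ * u i) (E.δ * a i)]
  have h0 : |(q - meshPoint E.δ a).re| ≤ (n + 1) * E.δ := by
    rw [Complex.sub_re, meshPoint_re]; exact tri _ 0 (by rw [← meshPoint_re]; exact hre)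
  have h1 : |(q - meshPoint E.δ a).im| ≤ (n + 1) * E.δ := by
    rw [Complex.sub_im, meshPoint_im]; exact tri _ 1 (by rw [← meshPoint_im]; exact him)
  have e0 : (q - meshPoint E.δ a).re ^ 2 ≤ ((n + 1) * E.δ) ^ 2 := by
    rw [← sq_abs]; exact pow_le_pow_left₀ (abs_nonneg _) h0 2
  have e1 : (q - meshPoint E.δ a).im ^ 2 ≤ ((n + 1) * E.δ) ^ 2 := by
    rw [← sq_abs]; exact pow_le_pow_left₀ (abs_nonneg _) h1 2
  have key : 2 * ((n + 1) * E.δ) ^ 2 ≤ (3 * n * E.δ) ^ 2 := by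
    have hpoly : (0 : ℝ) ≤ 7 * n ^ 2 - 4 * n - 2 := by nlinarith [hn']
    nlinarith [mul_nonneg (sq_nonneg E.δ) hpoly]
  have hsq : ‖q - meshPoint E.δ a‖ ^ 2 ≤ (3 * n * E.δ) ^ 2 := by
    rw [Complex.sq_norm, Complex.normSq_apply]
    nlinarith [e0, e1, key]
  exact (pow_le_pow_iff_left₀ (norm_nonneg _) (by positivity) two_ne_zero).1 hsq

/-! ### §4 Inside the square the completed spliced configuration is the fresh one -/

/-- Edges of a completed configuration are lattice edges. -/
theorem adj_of_mem_bcBondConfig {E : DiscreteDobrushin} {ω' : BondConfig (Site 2)} {x y : Site 2}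
    (he : s(x, y) ∈ E.bcBondConfig ω') : (zdGraph 2).Adj x y :=
  meshGraph_le_zdGraph _ _ (discreteDomainGraph_le_meshGraph _ _ he.1)

/-- An edge of `E.bcBondConfig (splice Q ξ ω)` with both endpoints in `Q` and an endpoint off the
discrete boundary is `ω`-open (the wired arc `A` lies on the boundary; the splice reads inner
edges of `Q` off `ω`). -/
theorem mem_of_mem_bcBondConfig_splice {E : DiscreteDobrushin} {Q : Set (Site 2)}
    {ξ ω : BondConfig (Site 2)} {x y : Site 2} (he : s(x, y) ∈ E.bcBondConfig (splice Q ξ ω))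
    (hx : x ∈ Q) (hy : y ∈ Q) (hxB : x ∉ E.zdBoundary) : s(x, y) ∈ ω := by
  obtain ⟨-, hA | ⟨hsp, -⟩⟩ := he
  · exact absurd (E.zdArcA_subset_zdBoundary (hA x (Sym2.mem_mk_left _ _))) hxB
  · rcases hsp with ⟨hω, -⟩ | ⟨-, hnQ⟩
    · exact hω
    · refine absurd (fun p hp => ?_) hnQ
      rcases Sym2.mem_iff.1 hp with rfl | rfl
      · exact hx
      · exact hy

/-! ### §5 An open path from the square to its outside crosses an annulus -/

/-- Coordinates are dominated by the Euclidean distance of mesh-`1` points. -/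
theorem abs_cast_sub_le_dist (x a : Site 2) (i : Fin 2) :
    |((x i : ℤ) : ℝ) - a i| ≤ dist (meshPoint 1 x) (meshPoint 1 a) := by
  rw [Complex.dist_eq]
  fin_cases i
  · have := Complex.abs_re_le_norm (meshPoint 1 x - meshPoint 1 a)
    simpa [Complex.sub_re, meshPoint_re] using this
  · have := Complex.abs_im_le_norm (meshPoint 1 x - meshPoint 1 a)
    simpa [Complex.sub_im, meshPoint_im] using this

/-- **Stopping an open path at its first exit.** If `β`-edges are lattice edges that are `ω`-open
between sites of `Q`, and every site at (mesh-`1`) distance `< R + 1` from `a` lies in `Q`, then a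
`β`-open walk from distance `< R` to distance `≥ R` from `a` contains an `ω`-open path from its
start to a site at distance `≥ R` through sites at distance `≤ R + 2` (as in `annulusOpenCrossing`). -/
theorem exists_openConnIn_of_walk {β ω : BondConfig (Site 2)} {Q : Set (Site 2)} {a : Site 2}
    {R : ℝ} (hQ : ∀ x : Site 2, dist (meshPoint 1 x) (meshPoint 1 a) < R + 1 → x ∈ Q)
    (hlat : ∀ x y : Site 2, s(x, y) ∈ β → (zdGraph 2).Adj x y)
    (hω : ∀ x y : Site 2, x ∈ Q → y ∈ Q → s(x, y) ∈ β → s(x, y) ∈ ω) {x c : Site 2}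
    (W : (openGraph β).Walk x c) (hc : R ≤ dist (meshPoint 1 c) (meshPoint 1 a))
    (hx : dist (meshPoint 1 x) (meshPoint 1 a) < R) :
    ∃ w, R ≤ dist (meshPoint 1 w) (meshPoint 1 a) ∧
      ω ∈ openConnIn {p : Site 2 | dist (meshPoint 1 p) (meshPoint 1 a) ≤ R + 2 * 1} x w := by
  induction W with
  | nil => exact absurd hc (not_le.2 hx)
  | @cons x y c' hxy W ih =>
    have hβ : s(x, y) ∈ β := ((openGraph_adj β x y).1 hxy).1
    have hadj := hlat x y hβ
    have hd : dist (meshPoint 1 x) (meshPoint 1 y) = 1 := by rw [dist_meshPoint_of_adj hadj, abs_one]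
    have hyR : dist (meshPoint 1 y) (meshPoint 1 a) < R + 1 := by
      linarith [dist_triangle (meshPoint 1 y) (meshPoint 1 x) (meshPoint 1 a),
        dist_comm (meshPoint (1 : ℝ) x) (meshPoint 1 y)]
    have hxQ : x ∈ Q := hQ x (by linarith)
    have hyQ : y ∈ Q := hQ y hyR
    have hωe : s(x, y) ∈ ω := hω x y hxQ hyQ hβ
    have hxS : x ∈ {p : Site 2 | dist (meshPoint 1 p) (meshPoint 1 a) ≤ R + 2 * 1} := by
      rw [Set.mem_setOf_eq]; linarith
    have hyS : y ∈ {p : Site 2 | dist (meshPoint 1 p) (meshPoint 1 a) ≤ R + 2 * 1} := by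
      rw [Set.mem_setOf_eq]; linarith
    have hxy' : ((openGraph ω).induce {p : Site 2 | dist (meshPoint 1 p) (meshPoint 1 a) ≤ R + 2 * 1}).Adj
        ⟨x, hxS⟩ ⟨y, hyS⟩ := by
      simp only [SimpleGraph.comap_adj, Function.Embedding.coe_subtype, openGraph_adj]
      exact ⟨hωe, hadj.ne⟩
    by_cases hy : R ≤ dist (meshPoint 1 y) (meshPoint 1 a)
    · exact ⟨y, hy, hxS, hyS, hxy'.reachable⟩
    · obtain ⟨w, hw, _, hwS, hreach⟩ := ih hc (not_le.1 hy)
      exact ⟨w, hw, hxS, hwS, hxy'.reachable.trans hreach⟩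

/-! ### §6 A passage through the centre of the square forces an annulus crossing -/

/-- For admissible data the medial exploration is the cut orbit of a start corner
(`MedialInterfaceProofs`: existence and uniqueness). -/
theorem exists_eq_explorationList {E : DiscreteDobrushin} (hE : E.IsZdAdmissible)
    (ω : BondConfig (Site 2)) :
    ∃ c₀ N, E.IsStartCorner c₀ ∧ medialExploration E ω = explorationList (E.bcBondConfig ω) c₀ N := by
  classical
  obtain ⟨c₀, hc₀, -⟩ := DiscreteDobrushin.existsUnique_startCorner hE
  have hc₀' : E.IsStartCorner c₀ := ⟨hc₀.1, hc₀.2.1, hc₀.2.2⟩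
  have hex := exists_not_isInnerFace_cornerOrbit (ω := ω) hE hc₀'
  exact ⟨c₀, Nat.find hex, hc₀', (isMedialExploration_medialExploration_holds E hE ω).eq_explorationList
    hE hc₀' (Nat.find_spec hex) fun k hk => not_not.1 (Nat.find_min hex hk)⟩

/-- **Passage ⇒ arm.** For admissible data, `n ≥ 2`, the closed `3nδ`-ball about `δa` in the
domain, a lattice edge `z ∋ a` and `r ≥ 1`: if the exploration of the spliced configuration
passes through `z`, the FRESH configuration `ω` crosses the annulus `A(a; r, n)` (mesh `1`) by an
open path — the left vertex of the dart sourced at `z` is joined to the start vertex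
`v_A ∈ ∂Ω_δ` (outside the square) by `β`-open edges, which inside the square are `ω`-open. -/
theorem annulusOpenCrossing_of_mem_medialExploration {E : DiscreteDobrushin} (hE : E.IsZdAdmissible)
    {a : Site 2} {n : ℕ} (hn : 2 ≤ n)
    (hball : Metric.closedBall (meshPoint E.δ a) (3 * n * E.δ) ⊆ E.Ω) (ξ : BondConfig (Site 2))
    {z : MedialVertex} (hz : z ∈ (zdGraph 2).edgeSet) (haz : a ∈ z) {r : ℝ} (hr : 1 ≤ r)
    {ω : BondConfig (Site 2)} (hmem : z ∈ medialExploration E (splice (latticeBox a n) ξ ω)) :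
    ω ∈ annulusOpenCrossing (meshPoint 1 a) 1 r n := by
  have hδ := hE.delta_pos
  have hn1 : 1 ≤ n := by omega
  -- the passage is the source of an orbit corner
  obtain ⟨c₀, N, hc₀, hγ⟩ := exists_eq_explorationList hE (splice (latticeBox a n) ξ ω)
  rw [hγ, explorationList] at hmem
  obtain ⟨k, -, hkz⟩ := List.mem_map.1 hmem
  set β := E.bcBondConfig (splice (latticeBox a n) ξ ω) with hβdef
  have hvz : (cornerOrbit β c₀ k).1 ∈ z := hkz ▸ Sym2.mem_mk_left _ _
  -- the left vertex is `a` or a neighbour of `a`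
  have hva : dist (meshPoint 1 (cornerOrbit β c₀ k).1) (meshPoint 1 a) ≤ 1 := by
    revert hz haz hvz
    induction z using Sym2.ind with
    | h x y =>
      intro hz haz hvz
      rw [SimpleGraph.mem_edgeSet] at hz
      rcases Sym2.mem_iff.1 haz with rfl | rfl <;> rcases Sym2.mem_iff.1 hvz with h | h <;> rw [h]
      · simp
      · rw [dist_comm, dist_meshPoint_of_adj hz, abs_one]
      · rw [dist_meshPoint_of_adj hz, abs_one]
      · simp
  -- the start vertex lies on the discrete boundary, hence outside the square
  have hc₀B : c₀.1 ∈ E.zdBoundary := E.zdArcA_subset_zdBoundary hc₀.mem_zdArcA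
  have hQ : ∀ x : Site 2, dist (meshPoint 1 x) (meshPoint 1 a) < n + 1 → x ∈ latticeBox a n := by
    intro x hx i
    have h := (abs_cast_sub_le_dist x a i).trans_lt hx
    have h' : ((|x i - a i| : ℤ) : ℝ) < (n : ℤ) + 1 := by push_cast; simpa [Int.cast_abs] using h
    have h'' : |x i - a i| < (n : ℤ) + 1 := by exact_mod_cast h'
    omega
  have hc : (n : ℝ) ≤ dist (meshPoint 1 c₀.1) (meshPoint 1 a) := by
    by_contra h
    exact not_mem_zdBoundary_of_mem_latticeBox hδ hn1 hball (hQ _ (by linarith)) hc₀B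
  have hlat : ∀ x y : Site 2, s(x, y) ∈ β → (zdGraph 2).Adj x y := fun x y he =>
    adj_of_mem_bcBondConfig he
  have hω : ∀ x y : Site 2, x ∈ latticeBox a n → y ∈ latticeBox a n → s(x, y) ∈ β → s(x, y) ∈ ω :=
    fun x y hx hy he =>
      mem_of_mem_bcBondConfig_splice he hx hy (not_mem_zdBoundary_of_mem_latticeBox hδ hn1 hball hx)
  obtain ⟨W⟩ := (reachable_cornerOrbit β c₀ k).symm
  have hvR : dist (meshPoint 1 (cornerOrbit β c₀ k).1) (meshPoint 1 a) < n := by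
    have : (2 : ℝ) ≤ n := by exact_mod_cast hn
    linarith
  obtain ⟨w, hw, hconn⟩ := exists_openConnIn_of_walk hQ hlat hω W hc hvR
  exact mem_annulusOpenCrossing_iff.2 ⟨_, hva.trans hr, w, hw, hconn⟩

/-! ### §7 The phase-free power bound -/

/-- **Phase-free a-priori bound for the conditional amplitude (registered glue
`condObs_powerBound`).** There are absolute constants `C` and `α > 0` such that for every admissible
datum, every site `a` whose closed `3nδ`-ball lies in the carrier, every outer configuration `ξ`
and every lattice edge `z ∋ a`, the conditional twisted passage amplitude resampled inside the
square `Q(a, n)` satisfies `‖condObs E (Q(a,n)) ξ z‖ ≤ C · n^{-α}`: a passage through `z` forces an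
`ω`-open crossing of `A(a; r, n)` (`annulusOpenCrossing_of_mem_medialExploration`), of probability
`≤ (r/n)^α` (RSW, `annulusOpenCrossing_half_le_holds`), and `‖passageSum‖ ≤ 2`. The PROVABLE
(positive-quantity) shadow of the conjecture-strength `KoebeShadowSquares` (exponent `1/3`). -/
theorem condObs_powerBound : ∃ C α : ℝ, 0 < α ∧ ∀ E : DiscreteDobrushin, E.IsZdAdmissible → ∀ (a : Site 2) (n : ℕ), 1 ≤ n → Metric.closedBall (meshPoint E.δ a) (3 * n * E.δ) ⊆ E.Ω → ∀ (ξ : BondConfig (Site 2)) (z : MedialVertex), z ∈ (zdGraph 2).edgeSet → a ∈ z → ‖condObs E (latticeBox a n) ξ z‖ ≤ C * (n : ℝ) ^ (-α) := by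
  obtain ⟨α, c₀, hα, hc₀, hbound⟩ := annulusOpenCrossing_half_le_holds
  set r := max c₀ 1 with hrdef
  have hr1 : 1 ≤ r := le_max_right _ _
  have hr0 : 0 < r := by linarith
  refine ⟨2 * (2 * r) ^ α, α, hα, fun E hE a n hn hball ξ z hz haz => ?_⟩
  have hn0 : (0 : ℝ) < n := by exact_mod_cast hn
  have h2 : ‖condObs E (latticeBox a n) ξ z‖ ≤ 2 := norm_condObs_le E _ ξ z
  by_cases hsmall : (n : ℝ) < 2 * r
  · have hle : (1 : ℝ) ≤ (2 * r) ^ α * (n : ℝ) ^ (-α) := by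
      rw [Real.rpow_neg hn0.le, ← div_eq_mul_inv, one_le_div (Real.rpow_pos_of_pos hn0 α)]
      exact Real.rpow_le_rpow hn0.le hsmall.le hα.le
    calc ‖condObs E (latticeBox a n) ξ z‖ ≤ 2 * 1 := by linarith
      _ ≤ 2 * ((2 * r) ^ α * (n : ℝ) ^ (-α)) := by gcongr
      _ = 2 * (2 * r) ^ α * (n : ℝ) ^ (-α) := by ring
  · push Not at hsmall
    have hn2 : 2 ≤ n := by
      have : (2 : ℝ) ≤ n := by linarith
      exact_mod_cast this
    set A := annulusOpenCrossing (meshPoint 1 a) 1 r n with hA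
    have hAm : MeasurableSet A := measurableSet_annulusOpenCrossing one_pos _ _ _
    have hdom : ∀ ω, ‖MedialPath.passageSum (medialExploration E (splice (latticeBox a n) ξ ω)) E.δ
        (1 / 3) z‖ ≤ A.indicator (fun _ => (2 : ℝ)) ω := by
      intro ω
      by_cases hmem : z ∈ medialExploration E (splice (latticeBox a n) ξ ω)
      · rw [Set.indicator_of_mem
          (annulusOpenCrossing_of_mem_medialExploration hE hn2 hball ξ hz haz hr1 hmem)]
        exact norm_passageSum_medialExploration_le_two _ _ _ _ _
      · rw [MedialPath.passageSum_eq_zero_of_not_mem _ _ hmem, norm_zero]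
        exact Set.indicator_nonneg (fun _ _ => zero_le_two) _
    have hint : Integrable (A.indicator fun _ => (2 : ℝ)) Pc := (integrable_const _).indicator hAm
    have hI := norm_integral_le_of_norm_le hint (Eventually.of_forall hdom)
    rw [integral_indicator_const _ hAm, smul_eq_mul] at hI
    have hP : Pc.real A ≤ (r / n) ^ α :=
      hbound (meshPoint 1 a) 1 r n one_pos (by rw [mul_one]; exact le_max_left _ _) hsmall
    calc ‖condObs E (latticeBox a n) ξ z‖ ≤ Pc.real A * 2 := hI
      _ ≤ (r / n) ^ α * 2 := by gcongr
      _ = 2 * r ^ α * (n : ℝ) ^ (-α) := by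
          rw [Real.div_rpow hr0.le hn0.le, Real.rpow_neg hn0.le]; ring
      _ ≤ 2 * (2 * r) ^ α * (n : ℝ) ^ (-α) := by
          gcongr
          linarith

end Summit.CriticalPhenomena.CardyFormulaZ2.Cruxes.ParafermionToSLESixFamilies.CaratheodoryNetSlitUniformity

end
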